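import Summits.CriticalPhenomena.PercolationContinuityZ3.Theorems.PercNearOneGluingNoHeavyQuantAtMostOne
import Summits.CriticalPhenomena.PercolationContinuityZ3.Theorems.PercNearOneGluingNoHeavyQuantAtMostOneAnalytic
import Literature.Combinatorics.StablePolynomials.GurvitsCapacityUnivariate
import HarnessLib

/-!
# QUANT lane R8 — "at most one open", part C: `AMO ≤ 1 − x` for at least FOUR blobs whose credit rates sum to `≥ 2`

builds on p205010 (kernel theorem, internal audit signed; external expert review pending)

Support file (`--supports stmt-CriticalPhenomena-4575`), QUANT lane typer seat prim-quant-stmt (gen 20).  Theorems only; local notation as in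
`…QuantAtMostOne` (part A: the `AMO` calculus) and the analytic lemmas of `…QuantAtMostOneAnalytic` (part B).

* **`Quant.IndepBlob.amo_le_of_four_le_card`** — `0 < y ≤ 1/2`; a finset `T` with `|T| ≥ 4`; per blob a credit `c k ∈ [0,1]` and a closure
  probability `0 ≤ q k ≤ y·(2 − y − c k)` (the PSEUDO-BLOB RELAXATION: equality for a light blob of Conjecture DIB\*, slack `x(g − x)` for a heavy
  one); `Σ_T c ≥ 2` ⟹ `AMO[T, q] ≤ y`.
  PROOF (all kernel, no case analysis on the heavy/light pattern): rescale the credits to sum exactly `2` and raise every `q k` to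
  `y·t k`, `t k = 2 − y − c' k` (`amo_mono`); in closed form `AMO[T, y·t] = y^{n−1} Σ_k (∏_{l≠k} t l)(1 − ((n−1)/n)·y·t k)`; AM–GM on each
  `∏_{l≠k} t l` (`Literature.….Gurvits.finset_prod_le_arith_mean_pow`, mean `= (2 − y − 2/(n−1)) + c' k/(n−1)`); the two chord inequalities in
  `c' k ∈ [0,1]`; summing with `Σ c' = 2` leaves `y·B'_n(y) ≤ y` (`boundPrime_le_one`).
The DIB\* consequences (every floor `1/2 ≤ x < 1`, any number of pairwise-completing blobs) are in `…QuantPairCompleting`.  [this work]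
-/

namespace Summit.CriticalPhenomena.PercolationContinuityZ3.Theorems

namespace Quant

namespace IndepBlob

open Finset

section Bound

variable {κ : Type} [DecidableEq κ]

/-- probability that at most one blob of `T` is open, closure probabilities `q` (as in `…QuantAtMostOne`) -/
local notation3 "AMO[" T ", " q "]" =>
  (∏ k ∈ (T : Finset κ), (q : κ → ℝ) k) + ∑ k ∈ (T : Finset κ), (1 - (q : κ → ℝ) k) * ∏ l ∈ (T : Finset κ).erase k, (q : κ → ℝ) l

/-! ### 1. At least four blobs: the analytic bound -/

/-- **`AMO ≤ y` FOR AT LEAST FOUR BLOBS (relaxed data).**  `0 < y ≤ 1/2`; on a finset `T` with `|T| ≥ 4`, credits `c k ∈ [0,1]` with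
`Σ_T c ≥ 2` and closure probabilities `0 ≤ q k ≤ y·(2 − y − c k)` ⟹ `AMO[T, q] ≤ y`.  Chain: rescale the credits to sum `2`, raise `q` to
`y·(2 − y − c')` (`amo_mono`), closed form of the pseudo system, AM–GM on each `∏_{l ≠ k}`, chord inequalities, `boundPrime_le_one`. [this work] -/
theorem amo_le_of_four_le_card (T : Finset κ) (hT : 4 ≤ T.card) (y : ℝ) (hy0 : 0 < y) (hy : y ≤ 1 / 2)
    (q c : κ → ℝ) (hc : ∀ k ∈ T, 0 ≤ c k ∧ c k ≤ 1) (hq : ∀ k ∈ T, 0 ≤ q k ∧ q k ≤ y * (2 - y - c k))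
    (hsum : 2 ≤ ∑ k ∈ T, c k) : AMO[T, q] ≤ y := by
  obtain ⟨m, hm⟩ : ∃ m : ℕ, T.card = m + 2 := ⟨T.card - 2, by omega⟩
  have hm2 : 2 ≤ m := by omega
  have hm2R : (2 : ℝ) ≤ m := by exact_mod_cast hm2
  have hm1 : (0 : ℝ) < (m : ℝ) + 1 := by positivity
  set C : ℝ := ∑ k ∈ T, c k with hC
  have hCpos : 0 < C := by linarith
  -- rescaled credits `c'` (sum exactly `2`), pseudo parameters `t = 2 − y − c'`, pseudo closure probabilities `q' = y t`
  obtain ⟨c', hc'⟩ : ∃ c' : κ → ℝ, ∀ k, c' k = 2 * c k / C := ⟨_, fun _ => rfl⟩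
  obtain ⟨t, ht⟩ : ∃ t : κ → ℝ, ∀ k, t k = 2 - y - c' k := ⟨_, fun _ => rfl⟩
  obtain ⟨q', hq'⟩ : ∃ q' : κ → ℝ, ∀ k, q' k = y * t k := ⟨_, fun _ => rfl⟩
  have hc'le : ∀ k ∈ T, c' k ≤ c k := fun k hk => by
    rw [hc', div_le_iff₀ hCpos]; nlinarith [(hc k hk).1]
  have hc'0 : ∀ k ∈ T, 0 ≤ c' k := fun k hk => by
    rw [hc']; exact div_nonneg (by nlinarith [(hc k hk).1]) hCpos.le
  have hc'1 : ∀ k ∈ T, c' k ≤ 1 := fun k hk => (hc'le k hk).trans (hc k hk).2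
  have hc'sum : ∑ k ∈ T, c' k = 2 := by
    simp_rw [hc']
    rw [← Finset.sum_div, ← Finset.mul_sum, ← hC]
    field_simp
  have ht0 : ∀ k ∈ T, 0 ≤ t k := fun k hk => by rw [ht]; linarith [hc'1 k hk]
  have htle : ∀ k ∈ T, t k ≤ 2 - y := fun k hk => by rw [ht]; linarith [hc'0 k hk]
  have hq'1 : ∀ k ∈ T, q' k ≤ 1 := fun k hk => by
    rw [hq']; nlinarith [htle k hk, ht0 k hk]
  -- (1) monotonicity
  have hmono : AMO[T, q] ≤ AMO[T, q'] := by
    refine amo_mono T q q' fun k hk => ⟨(hq k hk).1, ?_, hq'1 k hk⟩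
    rw [hq']
    exact (hq k hk).2.trans (mul_le_mul_of_nonneg_left (by rw [ht]; linarith [hc'le k hk]) hy0.le)
  refine hmono.trans ?_
  -- (2) closed form of the pseudo system
  have hn1 : ∀ k ∈ T, (T.erase k).card = m + 1 := fun k hk => by rw [Finset.card_erase_of_mem hk, hm]; omega
  have eP : ∀ k ∈ T, ∏ l ∈ T.erase k, q' l = y ^ (m + 1) * ∏ l ∈ T.erase k, t l := fun k hk => by
    rw [Finset.prod_congr rfl fun l _ => hq' l, Finset.prod_mul_distrib, Finset.prod_const, hn1 k hk]
  have eP0 : ∏ l ∈ T, q' l = y ^ (m + 2) * ∏ l ∈ T, t l := by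
    rw [Finset.prod_congr rfl fun l _ => hq' l, Finset.prod_mul_distrib, Finset.prod_const, hm]
  have eS : ∑ k ∈ T, t k * ∏ l ∈ T.erase k, t l = ((m : ℝ) + 2) * ∏ l ∈ T, t l := by
    rw [Finset.sum_congr rfl fun k hk => Finset.mul_prod_erase T t hk, Finset.sum_const, nsmul_eq_mul, hm]
    push_cast
    ring
  have eAMO : AMO[T, q'] =
      y ^ (m + 1) * ∑ k ∈ T, (∏ l ∈ T.erase k, t l) * (1 - ((m : ℝ) + 1) / ((m : ℝ) + 2) * y * t k) := by
    have h1 : ∑ k ∈ T, (1 - q' k) * ∏ l ∈ T.erase k, q' l =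
        y ^ (m + 1) * ∑ k ∈ T, ∏ l ∈ T.erase k, t l - y ^ (m + 2) * ∑ k ∈ T, t k * ∏ l ∈ T.erase k, t l := by
      rw [Finset.mul_sum, Finset.mul_sum, ← Finset.sum_sub_distrib]
      refine Finset.sum_congr rfl fun k hk => ?_
      rw [eP k hk, hq']
      ring
    have h2 : y ^ (m + 1) * ∑ k ∈ T, (∏ l ∈ T.erase k, t l) * (1 - ((m : ℝ) + 1) / ((m : ℝ) + 2) * y * t k) =
        y ^ (m + 1) * ∑ k ∈ T, ∏ l ∈ T.erase k, t l -
          y ^ (m + 2) * (((m : ℝ) + 1) / ((m : ℝ) + 2)) * ∑ k ∈ T, t k * ∏ l ∈ T.erase k, t l := by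
      rw [Finset.mul_sum, Finset.mul_sum, Finset.mul_sum, ← Finset.sum_sub_distrib]
      refine Finset.sum_congr rfl fun k _ => ?_
      ring
    rw [h2, eP0, h1, eS]
    field_simp
    ring
  rw [eAMO]
  -- (3) per-blob bound: AM–GM, then the chord inequalities
  set a₀ : ℝ := 2 - y - 2 / ((m : ℝ) + 1) with ha₀
  set β : ℝ := ((m : ℝ) + 1) / ((m : ℝ) + 2) * y with hβ
  set α : ℝ := 1 - β * (2 - y) with hα
  have ha₀0 : 0 ≤ a₀ := by
    have h : 2 / ((m : ℝ) + 1) ≤ 2 / 3 := div_le_div_of_nonneg_left (by norm_num) (by norm_num) (by linarith)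
    rw [ha₀]; linarith
  have hβ0 : 0 ≤ β := by positivity
  have hα0 : 0 ≤ α := by
    have hr : ((m : ℝ) + 1) / ((m : ℝ) + 2) ≤ 1 := by rw [div_le_one (by positivity)]; linarith
    have h1 : β * (2 - y) ≤ y * (2 - y) := by
      rw [hβ]; nlinarith [mul_le_mul_of_nonneg_right hr hy0.le]
    rw [hα]; nlinarith
  have hsumT : ∑ l ∈ T, t l = ((m : ℝ) + 2) * (2 - y) - 2 := by
    simp_rw [ht]
    rw [Finset.sum_sub_distrib, Finset.sum_const, hm, hc'sum, nsmul_eq_mul]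
    push_cast
    ring
  have hper : ∀ k ∈ T, (∏ l ∈ T.erase k, t l) * (1 - ((m : ℝ) + 1) / ((m : ℝ) + 2) * y * t k) ≤
      (1 - c' k) * (a₀ ^ (m + 1) * α) + c' k * ((a₀ + 1 / ((m : ℝ) + 1)) ^ (m + 1) * (α + β)) := by
    intro k hk
    have hne : (T.erase k).Nonempty := by rw [← Finset.card_pos, hn1 k hk]; omega
    have hamgm := Literature.Combinatorics.StablePolynomials.Gurvits.finset_prod_le_arith_mean_pow (T.erase k) t
      (fun l hl => ht0 l (Finset.mem_of_mem_erase hl)) hne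
    rw [hn1 k hk, Finset.sum_erase_eq_sub hk, hsumT] at hamgm
    have hmean : (((m : ℝ) + 2) * (2 - y) - 2 - t k) / ((m + 1 : ℕ) : ℝ) = a₀ + 1 / ((m : ℝ) + 1) * c' k := by
      rw [ht, ha₀]; push_cast; field_simp; ring
    rw [hmean] at hamgm
    have hch := pow_affine_le_chord a₀ (1 / ((m : ℝ) + 1)) ha₀0 (by positivity) (c' k) (hc'0 k hk) (hc'1 k hk) (m + 1)
    have hfac : 1 - ((m : ℝ) + 1) / ((m : ℝ) + 2) * y * t k = α + β * c' k := by
      rw [hα, hβ, ht]; ring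
    rw [hfac]
    have hmon : a₀ ^ (m + 1) ≤ (a₀ + 1 / ((m : ℝ) + 1)) ^ (m + 1) :=
      pow_le_pow_left₀ ha₀0 (le_add_of_nonneg_right (by positivity)) _
    exact chord_mul_affine _ _ _ α β (c' k) (hc'0 k hk) (hc'1 k hk) hα0 hβ0 hmon (hamgm.trans hch)
  -- (4) sum over the blobs: `Σ (1 − c')·F₀ + c'·F₁ = m·F₀ + 2·F₁`
  have hsum_le : ∑ k ∈ T, (∏ l ∈ T.erase k, t l) * (1 - ((m : ℝ) + 1) / ((m : ℝ) + 2) * y * t k) ≤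
      (m : ℝ) * (a₀ ^ (m + 1) * α) + 2 * ((a₀ + 1 / ((m : ℝ) + 1)) ^ (m + 1) * (α + β)) := by
    refine (Finset.sum_le_sum hper).trans (le_of_eq ?_)
    rw [Finset.sum_add_distrib, ← Finset.sum_mul, ← Finset.sum_mul, Finset.sum_sub_distrib, Finset.sum_const, hm,
      hc'sum, nsmul_eq_mul]
    push_cast
    ring
  -- (5) the numeric bound
  have hB := boundPrime_le_one m hm2 y hy0.le hy
  have e1 : a₀ + 1 / ((m : ℝ) + 1) = 2 - y - 1 / ((m : ℝ) + 1) := by rw [ha₀]; ring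
  have e2 : α = 1 - ((m : ℝ) + 1) / ((m : ℝ) + 2) * y * (2 - y) := by rw [hα, hβ]
  have e3 : α + β = 1 - ((m : ℝ) + 1) / ((m : ℝ) + 2) * y * (1 - y) := by rw [hα, hβ]; ring
  rw [e1, e2, e3] at hsum_le
  have hy1 : 0 ≤ y ^ (m + 1) := pow_nonneg hy0.le _
  calc y ^ (m + 1) * ∑ k ∈ T, (∏ l ∈ T.erase k, t l) * (1 - ((m : ℝ) + 1) / ((m : ℝ) + 2) * y * t k)
      ≤ y ^ (m + 1) * ((m : ℝ) * (a₀ ^ (m + 1) * (1 - ((m : ℝ) + 1) / ((m : ℝ) + 2) * y * (2 - y))) +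
          2 * ((2 - y - 1 / ((m : ℝ) + 1)) ^ (m + 1) * (1 - ((m : ℝ) + 1) / ((m : ℝ) + 2) * y * (1 - y)))) :=
        mul_le_mul_of_nonneg_left hsum_le hy1
    _ = y * (y ^ m * ((m : ℝ) * (2 - y - 2 / ((m : ℝ) + 1)) ^ (m + 1) * (1 - ((m : ℝ) + 1) / ((m : ℝ) + 2) * y * (2 - y)) +
          2 * (2 - y - 1 / ((m : ℝ) + 1)) ^ (m + 1) * (1 - ((m : ℝ) + 1) / ((m : ℝ) + 2) * y * (1 - y)))) := by
        rw [ha₀]; ring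
    _ ≤ y * 1 := mul_le_mul_of_nonneg_left hB hy0.le
    _ = y := mul_one y

end Bound

end IndepBlob

end Quant

end Summit.CriticalPhenomena.PercolationContinuityZ3.Theorems
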